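import Mathlib
import Summits.Ventures.PercRepro.TriangleCapStarFamilyWitness

/-!
# PercRepro — ONE BELOW THE THRESHOLD: THE STAR FAMILY WITH `r − 1` INSIDE EDGES BEATS THE BIPARTITE BOTTOM FOR
`r ≥ 3` (p3, gen 56; part 324)

At `m = D + r − 2` (one below the threshold of part 319, `2 ≤ r`, `2 r ≤ D`) the star family with `a = r − 1`
specials, `Rc = r` centre rows, the first centre row reduced to the centre alone (`short = D − 1`), no extra row and
`Q = D − 1` regular columns is a graph of the band with `t = m D + r` and
`2 j + 2 t (D − 1) = t (t − 1) + 2 r (D − r) − 2 (r − 1)(r − 2)` (`zone_one_below_witness`): for `r ≥ 3` this is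
BELOW the bipartite bottom `t (t − 1) + 2 r (D − r)` of part 307 — the census guess of §10dq(h) («the bipartite value
below the threshold», drawn from `r = 2` cells only) fails from `r = 3` on, e.g. at `(D, r, m) = (6, 3, 7)`, `t = 45`,
where the value is `t (t − 1) + 14 < t (t − 1) + 18`.  With part 321 the bottom there lies in
`[2 r (D − 2 r + 1) + 2, 2 r (D − r) − 2 (r − 1)(r − 2)]`.  Axioms: standard.
-/

namespace PercRepro

namespace TriangleCap

namespace C047

open Finset

/-- **ONE BELOW THE THRESHOLD:** for `2 ≤ r`, `2 r ≤ D`, `m = D + r − 2`, `t = m D + r`, `m + 1 ≤ ℓ`, `2 t ≤ s`, a graph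
of the band on `ℓ + 1 + (s − t)` vertices with `2 j + 2 t (D − 1) + 2 (r − 1)(r − 2) = t (t − 1) + 2 r (D − r)`. -/
theorem zone_one_below_witness (s ℓ m r D : ℕ) (hr : 2 ≤ r) (h2 : 2 * r ≤ D) (hm : m + 2 = D + r) (hmℓ : m + 1 ≤ ℓ)
    (hs : 2 * (m * D + r) ≤ s) :
    ∃ (H : SimpleGraph (Fin (ℓ + 1 + (s - (m * D + r))))) (_ : DecidableRel H.Adj), H.CliqueFree 3 ∧
      H.edgeFinset.card = s ∧ ∃ w, deg H w + (m * D + r) = s ∧ (∀ v, offDeg H w v ≤ D) ∧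
        (∃ x, ¬ H.Adj w x ∧ offDeg H w x = D) ∧
        ∃ j, ∑ v, deg H v * deg H v + 2 * ((m * D + r) * (s - (m * D + r) - 1)) + 2 * j = s * (s + 1) ∧
          2 * j + 2 * ((m * D + r) * (D - 1)) + 2 * ((r - 1) * (r - 2)) = (m * D + r) * (m * D + r - 1) + 2 * (r * (D - r)) := by
  -- `a = r − 1`, `Rc = r`, `short = D − 1`, `E = 0`, `Q = D − 1`
  obtain ⟨r', rfl⟩ : ∃ r', r = r' + 2 := ⟨r - 2, by omega⟩
  obtain ⟨u, rfl⟩ : ∃ u, D = 2 * (r' + 2) + u := ⟨D - 2 * (r' + 2), by omega⟩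
  have hmv : m = 3 * r' + u + 4 := by omega
  subst hmv
  have ht : (3 * r' + u + 4) * (2 * (r' + 2) + u) + (r' + 2) =
      r' + 2 + (r' + 2 - 1) * (2 * (r' + 2) + u - 1) + (2 * (r' + 2) + u - 1) * (2 * (r' + 2) + u) + (r' + 2 - 1) := by
    have e1 : r' + 2 - 1 = r' + 1 := by omega
    have e2 : 2 * (r' + 2) + u - 1 = 2 * r' + u + 3 := by omega
    rw [e1, e2]
    ring
  have hinc : (r' + 2) * (2 * (r' + 2) + u - 1) + (2 * (r' + 2) + u - 1) * (2 * (r' + 2) + u - (r' + 2 - 1)) +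
      0 * (2 * (r' + 2) + u) = (2 * (r' + 2) + u - 1) * (2 * (r' + 2) + u) + (2 * (r' + 2) + u - 1) := by
    have e1 : r' + 2 - 1 = r' + 1 := by omega
    have e2 : 2 * (r' + 2) + u - 1 = 2 * r' + u + 3 := by omega
    have e3 : 2 * (r' + 2) + u - (r' + 1) = r' + u + 3 := by omega
    rw [e1, e2, e3]
    ring
  obtain ⟨H, inst, hfree, hcard, w, hw, hD', hx, j, hj, hval⟩ :=
    starFamilyWitness s ℓ ((3 * r' + u + 4) * (2 * (r' + 2) + u) + (r' + 2)) (2 * (r' + 2) + u) (r' + 2 - 1) (r' + 2)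
      (2 * (r' + 2) + u - 1) 0 (2 * (r' + 2) + u - 1) ht (by omega) (by omega) (by omega) (by omega) (by omega)
      (by omega) (fun h => absurd h (by omega)) hinc (by omega) hs
  refine ⟨H, inst, hfree, hcard, w, hw, hD', hx, j, hj, ?_⟩
  rw [hval]
  have e1 : r' + 2 - 1 = r' + 1 := by omega
  have e2 : 2 * (r' + 2) + u - 1 = 2 * r' + u + 3 := by omega
  have e3 : 2 * (r' + 2) + u - (r' + 2 + (r' + 2 - 1)) = u + 1 := by omega
  have e4 : 2 * (r' + 2) + u - (2 * (r' + 2) + u - 1) = 1 := by omega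
  have e5 : r' + 2 - 2 = r' := by omega
  have e6 : 2 * (r' + 2) + u - (r' + 2) = r' + 2 + u := by omega
  rw [e3, e4, e1, e2, e5, e6]
  ring

end C047

end TriangleCap

end PercRepro
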